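/-
Copyright (c) 2026 the pub-hodgecm-mathlib formalisation cell (harness21).  Prover seat hodgecm-mathlib-K2Liu-p14 (g5) (cross-line VALVE 16 (n) hand at section S6,
dealer R90-C14-plan (g2)), card «E2♭-COUNT» dealt BY NAME 2026-09-05T03:25:25Z, census 03:31Z (spec authority K2E3-p28 (g4) «=» 03:32:39Z: order (a) → (b) → (c)).
FILE 1b = the two count heads (a), (b) over FILE 1a's letters.  THEOREMS ONLY (no `def`, no `instance`, no notation, no named-fact hypothesis, no `sorry`); lane
`--supports stmt-HodgeConjecture-24833 --as helper` (count-neutral helper).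
-/
import Summits.HodgeConjecture.HodgeConjecture.Theorems.R90S6TorusFixedSpecialCountUnipotent          -- ★ G1 RUNG 1 `natCard_fixedBy_special_eq_one_add_mul_of_residually_unipotent`; brings ★ W8-i′ FILE 1
import Summits.HodgeConjecture.HodgeConjecture.Theorems.R90S6TorusFixedSpecialCountTypeTwoShallowLetters   -- FILE 1a (this seat): §1 obstruction, §2 unipotence, `|u| = 1`
import HarnessLib

/-!
# R90 · S6 — card «E2♭-COUNT» FILE 1b `R90S6TorusFixedSpecialCountTypeTwoShallowOne`: THE SHALLOW SPECIAL COUNTS OF A TYPE-(2) ELEMENT —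
# `#Fix_γ(U ⧸ K₁) = 1` in the regime `n = 1` (`N = 0`, both `κ`-classes), and for an element with no fixed hyperspecial vertex

Cell `hodgecm-mathlib`, crux H413 (`stmt-HodgeConjecture-24833`), route `HCCMUnconditional`; programme R90-TF, section S6 (base `R90-C14`), row E1.3.5.2.6, target (E2♭) of
typ1's sheet v2.3.  The reduction (K2E3-p28 (g4) `kappaDiff_ncard_displaced_typeTwo_eq_sum_xiHCoeff_of_unitLevels`) consumes `(V₀ᵢ, V₁ᵢ)` of the two `κ`-classes in GF1-2a
coset currency; the hyperspecial columns `V₀` are ★ at every depth (★ a₀ ∕ ★ (G2-ODD) A, shallow rows = FILE 1a §0); this file gives the SPECIAL columns `V₁` in the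
shallow regimes except the one deep-geometry value (`n = 0`, even class: `Σ_{k≤N} q^k` — FILE 2):
* **(a)** `natCard_fixedBy_special_eq_one_of_typeTwo_levelZero`: `n = 1` (`N = 0`), BOTH classes (any parity of the anisotropic eigenline): **`#Fix_γ(U ⧸ K₁) = 1`** — ★ rung 1
  `a₁ + ℓ₁ = 1 + S·ℓ₁` at `c := u` (`χ_γ ≡ (X − u)³` by FILE 1a §2) with `ℓ₁ = 0` by FILE 1a §1 (a level-one fixed hyperspecial vertex would force `|disc| ≤ |ϖ²|`,
  contradicting `|disc| = |ϖ^{2·0+1}|`; trace, determinant and the eigenvalue are conjugation invariants of the local monodromy `k_x = r(x)⁻¹γr(x)`);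
* **(b)** `natCard_fixedBy_special_eq_one_of_natCard_fixedBy_hyperspecial_eq_zero`: NO fixed hyperspecial coset ⇒ exactly ONE fixed special coset (★ W8-i′ FILE 1
  `a₁ + a₀ = 1 + Σ_{x ∈ Fix_hyp} s(x)` with the empty sum) — the odd class at `n = 0` (`a₀ = phiTHprimen q 0 N = 0`, FILE 1a §0 + ★ (G2-ODD) A); letter-free, so it also
  serves ★ R2M's `(3b)(3d)` shape without the R-II letters.
Flicker's `N = 0` row, for the record: `V₀ = (1, q+1)`, `V₁ = (1, 1)` (`Δ·(V₀₁ − V₀₂) = (−q)⁻¹·(−q) = 1 = P`, `Δ·(V₁₁ − V₁₂) = 0 = P − 1` ✓, K2E3-p28 03:32:39Z).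
HONEST LABEL: counts over ★ rungs; proves no printed global statement, discharges no citation; count-neutral helper until (E2♭)'s reduction consumes it.  HC_CM is proved only
modulo the 7 printed citations (2 remaining named inputs: hLiu418 = stmt-HodgeConjecture-24832, h413 = stmt-HodgeConjecture-24833) until rung 0 closes.

## References
* [Flicker1998UnitaryFL] Y. Z. Flicker, *Elementary proof of the fundamental lemma for a unitary group*, Canad. J. Math. 50 (1998), Prop. 11 p. 87, Prop. 17 p. 97, Theorem 18 p. 97.
* [Rogawski1990] J. D. Rogawski, *Automorphic Representations of Unitary Groups in Three Variables* (1990), §3.6 Lemma 3.6.1, §3.9 p. 32, §4.9 Prop. 4.9.1 (b) pp. 54–56.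
* [Kottwitz1988] R. E. Kottwitz, *Tamagawa numbers*, Ann. of Math. 127 (1988), §2 (fixed subtrees; the two parahoric levels).
* [Serre1980Trees] J.-P. Serre, *Trees* (1980), Ch. I §6.1 (fixed points form a subtree), II.1.1.
-/

set_option autoImplicit false
-- the mandated namespace repeats the single-problem summit's segment (`HodgeConjecture.HodgeConjecture`)
set_option linter.dupNamespace false

noncomputable section

open MulAction Polynomial
open Literature.NumberTheory.Automorphic Literature.NumberTheory.Automorphic.HermitianLattice Literature.NumberTheory.Automorphic.UnitaryGroup
open Literature.NumberTheory.Automorphic.UnitaryLatticeTree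
open scoped Matrix MatrixGroups WithZero Valued

namespace Summit.HodgeConjecture.HodgeConjecture.R90.S6

/-! ## (a): the special count in the regime `n = 1` (`N = 0`), both `κ`-classes -/

universe v in
set_option synthInstance.maxHeartbeats 400000 in
set_option maxHeartbeats 1600000 in
-- the iterated subgroup-quotient carriers `↥K₀ ⧸ I_{K₀}` of ★ W8-i′ FILE 1 ∕ ★ rung 1 are slow to elaborate at `U(Φ₃)` (same budget as ★ rung 1, ★ (R2))
/-- **«E2♭-COUNT» (a): `#Fix_γ(U ⧸ K₁) = 1` IN THE REGIME `n = 1` (`N = 0`), FOR BOTH `κ`-CLASSES.**  `K` with the non-dyadic datum `hd : LocalConjDatum σ ϖ`; `γ ∈ U(σ, J₀)(K)` with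
an ANISOTROPIC eigenvector `γx = ux` (`|B₀(x,x)| = exp kx`, any parity `kx` — the even literal class AND the odd intrinsic class of (E2♭)), ★ a₀'s exponent letters `hN hn` with
`N = 0` and `1 ≤ n`, and ★ rung 1's coset letters VERBATIM (`g₁ hg₁`, `[Fintype Fix_γ(U⧸K₀)]`, `hK₁fin`, `horb`, section `r hr`, the residual-finiteness instance).  Then the
number of `γ`-fixed SPECIAL vertices is `1`: ★ rung 1 gives `a₁ + ℓ₁ = 1 + S·ℓ₁` (`χ_γ ≡ (X − u)³` by FILE 1a §2), and `ℓ₁ = 0` by FILE 1a §1 — a level-one fixed hyperspecial vertex would force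
`|disc| ≤ |ϖ|²`, contradicting `|disc| = |ϖ^{2·0+1}|`.  Flicker's `N = 0` row: `V₀ = (1, q+1)`, `V₁ = (1, 1)` for the two classes.
[cite: Flicker1998UnitaryFL, Theorem 18 p. 97; Prop. 11 p. 87; Prop. 17 p. 97] [cite: Kottwitz1988, §2] [cite: Rogawski1990, §3.9 p. 32; §4.9 Prop. 4.9.1 (b) p. 55] -/
theorem natCard_fixedBy_special_eq_one_of_typeTwo_levelZero {K : Type v} [Field K] [Valued K ℤᵐ⁰] [ValuativeRel K] [(Valued.v : Valuation K ℤᵐ⁰).Compatible]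
    {σ : K →+* K} {ϖ : K} (hd : LocalConjDatum σ ϖ)
    (g₁ : GL (Fin 3) K) (hg₁ : (g₁ : Matrix (Fin 3) (Fin 3) K) = Matrix.diagonal ![(1 : K), 1, ϖ])
    (γ : ↥(unitaryGroupOfForm σ ((StdForm.antidiagonal 3).over K)))
    [Fintype (fixedBy (↥(unitaryGroupOfForm σ ((StdForm.antidiagonal 3).over K)) ⧸
      (glInt 3 K).subgroupOf (unitaryGroupOfForm σ ((StdForm.antidiagonal 3).over K))) γ)]
    (hK₁fin : (fixedBy (↥(unitaryGroupOfForm σ ((StdForm.antidiagonal 3).over K)) ⧸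
      ((glInt 3 K).map (MulAut.conj g₁).toMonoidHom).subgroupOf (unitaryGroupOfForm σ ((StdForm.antidiagonal 3).over K))) γ).Finite)
    (horb : (Set.range fun n : ℕ => ((γ ^ n : ↥(unitaryGroupOfForm σ ((StdForm.antidiagonal 3).over K))) :
      ↥(unitaryGroupOfForm σ ((StdForm.antidiagonal 3).over K)) ⧸ (glInt 3 K).subgroupOf (unitaryGroupOfForm σ ((StdForm.antidiagonal 3).over K)))).Finite)
    (r : ↥(unitaryGroupOfForm σ ((StdForm.antidiagonal 3).over K)) ⧸ (glInt 3 K).subgroupOf (unitaryGroupOfForm σ ((StdForm.antidiagonal 3).over K)) →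
      ↥(unitaryGroupOfForm σ ((StdForm.antidiagonal 3).over K)))
    (hr : Function.RightInverse r QuotientGroup.mk)
    [∀ x : fixedBy (↥(unitaryGroupOfForm σ ((StdForm.antidiagonal 3).over K)) ⧸
        (glInt 3 K).subgroupOf (unitaryGroupOfForm σ ((StdForm.antidiagonal 3).over K))) γ,
      Finite (fixedBy (↥((glInt 3 K).subgroupOf (unitaryGroupOfForm σ ((StdForm.antidiagonal 3).over K))) ⧸
        (((glInt 3 K).subgroupOf (unitaryGroupOfForm σ ((StdForm.antidiagonal 3).over K)) ⊓
          ((glInt 3 K).map (MulAut.conj g₁).toMonoidHom).subgroupOf (unitaryGroupOfForm σ ((StdForm.antidiagonal 3).over K))).subgroupOf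
          ((glInt 3 K).subgroupOf (unitaryGroupOfForm σ ((StdForm.antidiagonal 3).over K)))))
        (⟨(r x.1)⁻¹ * γ * r x.1, inv_mul_mul_mem_of_smul_eq r hr γ x.2⟩ :
          ↥((glInt 3 K).subgroupOf (unitaryGroupOfForm σ ((StdForm.antidiagonal 3).over K)))))]
    -- the type-(2) data of `γ`: ANISOTROPIC eigenvector `x` (eigenvalue `u`, any parity), exponents `(n, N)` in ★ a₀'s letters
    {x : Fin 3 → K} {u : K} (hγx : (((γ : ↥(unitaryGroupOfForm σ ((StdForm.antidiagonal 3).over K))) : GL (Fin 3) K) : Matrix (Fin 3) (Fin 3) K) *ᵥ x = u • x)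
    {kx : ℤ} (hx : Valued.v (B₀ σ 3 x x) = WithZero.exp kx)
    {N n : ℕ} (hN : Valued.v ((Matrix.trace (((γ : ↥(unitaryGroupOfForm σ ((StdForm.antidiagonal 3).over K))) : GL (Fin 3) K) : Matrix (Fin 3) (Fin 3) K) - u) ^ 2 -
      4 * (Matrix.det (((γ : ↥(unitaryGroupOfForm σ ((StdForm.antidiagonal 3).over K))) : GL (Fin 3) K) : Matrix (Fin 3) (Fin 3) K) / u)) = Valued.v (ϖ ^ (2 * N + 1)))
    (hn : Valued.v (u ^ 2 - (Matrix.trace (((γ : ↥(unitaryGroupOfForm σ ((StdForm.antidiagonal 3).over K))) : GL (Fin 3) K) : Matrix (Fin 3) (Fin 3) K) - u) * u +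
      Matrix.det (((γ : ↥(unitaryGroupOfForm σ ((StdForm.antidiagonal 3).over K))) : GL (Fin 3) K) : Matrix (Fin 3) (Fin 3) K) / u) = Valued.v (ϖ ^ n))
    (hN0 : N = 0) (hn1 : 1 ≤ n) :
    Nat.card (fixedBy (↥(unitaryGroupOfForm σ ((StdForm.antidiagonal 3).over K)) ⧸
        ((glInt 3 K).map (MulAut.conj g₁).toMonoidHom).subgroupOf (unitaryGroupOfForm σ ((StdForm.antidiagonal 3).over K))) γ) = 1 := by
  subst hN0
  have hϖ0 : ϖ ≠ 0 := hd.ϖ_ne_zero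
  have hvϖ := hd.vϖ
  have hvpow : ∀ j : ℕ, Valued.v (ϖ ^ j) = WithZero.exp (-(j : ℤ)) := fun j => by
    rw [map_pow, hvϖ, ← WithZero.exp_nsmul, nsmul_eq_mul, mul_neg, mul_one]
  -- `|u| = 1` (anisotropic eigenvector) and `x ≠ 0`
  have hx0 : B₀ σ 3 x x ≠ 0 := fun h0 => by rw [h0, map_zero] at hx; exact WithZero.coe_ne_zero hx.symm
  have hx' : x ≠ 0 := fun h0 => hx0 (by simp [h0])
  obtain ⟨-, hvu⟩ := norm_eigenvalue_eq_one_of_anisotropic hd.vσ hγx hx0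
  -- the residual unipotence `χ_γ ≡ (X − u)³` (FILE 1a §2)
  have hD : Valued.v ((Matrix.trace (((γ : ↥(unitaryGroupOfForm σ ((StdForm.antidiagonal 3).over K))) : GL (Fin 3) K) : Matrix (Fin 3) (Fin 3) K) - u) ^ 2 -
      4 * (Matrix.det (((γ : ↥(unitaryGroupOfForm σ ((StdForm.antidiagonal 3).over K))) : GL (Fin 3) K) : Matrix (Fin 3) (Fin 3) K) / u)) < 1 := by
    rw [hN, hvpow, ← WithZero.exp_zero, WithZero.exp_lt_exp]; norm_num
  have hQ : Valued.v (u ^ 2 - (Matrix.trace (((γ : ↥(unitaryGroupOfForm σ ((StdForm.antidiagonal 3).over K))) : GL (Fin 3) K) : Matrix (Fin 3) (Fin 3) K) - u) * u +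
      Matrix.det (((γ : ↥(unitaryGroupOfForm σ ((StdForm.antidiagonal 3).over K))) : GL (Fin 3) K) : Matrix (Fin 3) (Fin 3) K) / u) < 1 := by
    rw [hn, hvpow, ← WithZero.exp_zero, WithZero.exp_lt_exp]; omega
  have hχ := charpoly_sub_pow_three_coeff_lt_one_of_eigen hγx hx' hvu hD hQ
  -- ★ RUNG 1 at `c := u`: `a₁ + ℓ₁ = 1 + S·ℓ₁`
  have h1 := natCard_fixedBy_special_eq_one_add_mul_of_residually_unipotent hd.toUnramified g₁ hg₁ γ hK₁fin horb r hr hvu hχ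
  -- `ℓ₁ = 0`: no fixed hyperspecial vertex is of level one (FILE 1a §1 against `hN` at `N = 0`)
  have hempty : IsEmpty {z : fixedBy (↥(unitaryGroupOfForm σ ((StdForm.antidiagonal 3).over K)) ⧸
        (glInt 3 K).subgroupOf (unitaryGroupOfForm σ ((StdForm.antidiagonal 3).over K))) γ //
      ∀ i j, Valued.v (((((r z.1)⁻¹ * γ * r z.1 : ↥(unitaryGroupOfForm σ ((StdForm.antidiagonal 3).over K))) : GL (Fin 3) K) :
        Matrix (Fin 3) (Fin 3) K) i j - u * (1 : Matrix (Fin 3) (Fin 3) K) i j) < 1} := by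
    refine ⟨fun z => ?_⟩
    obtain ⟨z, hz⟩ := z
    -- `k_z = R⁻¹ γ R` with `R = r(z)`; its eigenvector `R⁻¹ x`
    have hRR : (((r z.1 : ↥(unitaryGroupOfForm σ ((StdForm.antidiagonal 3).over K))) : GL (Fin 3) K) : Matrix (Fin 3) (Fin 3) K) *
        ((((r z.1 : ↥(unitaryGroupOfForm σ ((StdForm.antidiagonal 3).over K))) : GL (Fin 3) K)⁻¹ : GL (Fin 3) K) : Matrix (Fin 3) (Fin 3) K) = 1 := by
      rw [← Units.val_mul, mul_inv_cancel, Units.val_one]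
    have hmat : ((((r z.1)⁻¹ * γ * r z.1 : ↥(unitaryGroupOfForm σ ((StdForm.antidiagonal 3).over K))) : GL (Fin 3) K) : Matrix (Fin 3) (Fin 3) K) =
        ((((r z.1 : ↥(unitaryGroupOfForm σ ((StdForm.antidiagonal 3).over K))) : GL (Fin 3) K)⁻¹ : GL (Fin 3) K) : Matrix (Fin 3) (Fin 3) K) *
          (((γ : ↥(unitaryGroupOfForm σ ((StdForm.antidiagonal 3).over K))) : GL (Fin 3) K) : Matrix (Fin 3) (Fin 3) K) *
          (((r z.1 : ↥(unitaryGroupOfForm σ ((StdForm.antidiagonal 3).over K))) : GL (Fin 3) K) : Matrix (Fin 3) (Fin 3) K) := by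
      rw [Subgroup.coe_mul, Subgroup.coe_mul, Units.val_mul, Units.val_mul, Subgroup.coe_inv]
    have hkx : ((((r z.1)⁻¹ * γ * r z.1 : ↥(unitaryGroupOfForm σ ((StdForm.antidiagonal 3).over K))) : GL (Fin 3) K) : Matrix (Fin 3) (Fin 3) K) *ᵥ
        (((((r z.1 : ↥(unitaryGroupOfForm σ ((StdForm.antidiagonal 3).over K))) : GL (Fin 3) K)⁻¹ : GL (Fin 3) K) : Matrix (Fin 3) (Fin 3) K) *ᵥ x) =
        u • (((((r z.1 : ↥(unitaryGroupOfForm σ ((StdForm.antidiagonal 3).over K))) : GL (Fin 3) K)⁻¹ : GL (Fin 3) K) : Matrix (Fin 3) (Fin 3) K) *ᵥ x) := by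
      rw [hmat, Matrix.mulVec_mulVec, Matrix.mul_assoc, Matrix.mul_assoc, hRR, Matrix.mul_one, ← Matrix.mulVec_mulVec, hγx, Matrix.mulVec_smul]
    have hx'' : ((((r z.1 : ↥(unitaryGroupOfForm σ ((StdForm.antidiagonal 3).over K))) : GL (Fin 3) K)⁻¹ : GL (Fin 3) K) : Matrix (Fin 3) (Fin 3) K) *ᵥ x ≠ 0 := by
      intro h0
      apply hx'
      have h := congrArg (fun y => (((r z.1 : ↥(unitaryGroupOfForm σ ((StdForm.antidiagonal 3).over K))) : GL (Fin 3) K) : Matrix (Fin 3) (Fin 3) K) *ᵥ y) h0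
      simp only [Matrix.mulVec_mulVec, hRR, Matrix.one_mulVec, Matrix.mulVec_zero] at h
      exact h
    have hle := v_planeDisc_le_sq_of_congr_scalar_of_eigen hvϖ hvu hz hkx hx''
    rw [hmat, Matrix.trace_units_conj', Matrix.det_units_conj', hN, hvpow, hvpow, WithZero.exp_le_exp] at hle
    norm_num at hle
  have hℓ : Nat.card {z : fixedBy (↥(unitaryGroupOfForm σ ((StdForm.antidiagonal 3).over K)) ⧸
        (glInt 3 K).subgroupOf (unitaryGroupOfForm σ ((StdForm.antidiagonal 3).over K))) γ //
      ∀ i j, Valued.v (((((r z.1)⁻¹ * γ * r z.1 : ↥(unitaryGroupOfForm σ ((StdForm.antidiagonal 3).over K))) : GL (Fin 3) K) :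
        Matrix (Fin 3) (Fin 3) K) i j - u * (1 : Matrix (Fin 3) (Fin 3) K) i j) < 1} = 0 := @Nat.card_of_isEmpty _ hempty
  rw [hℓ, add_zero, mul_zero, add_zero] at h1
  exact h1

/-! ## (b): no fixed hyperspecial vertex ⇒ exactly one fixed special vertex -/

universe w in
set_option synthInstance.maxHeartbeats 400000 in
set_option maxHeartbeats 1600000 in
-- the iterated subgroup-quotient carriers `↥K₀ ⧸ I_{K₀}` of ★ W8-i′ FILE 1 are slow to elaborate at `U(Φ₃)` (same budget as ★ FILE 1)
/-- **«E2♭-COUNT» (b): AN ELEMENT WITH NO FIXED HYPERSPECIAL VERTEX FIXES EXACTLY ONE SPECIAL VERTEX** — ★ W8-i′ FILE 1 `a₁ + a₀ = 1 + Σ_{x ∈ Fix_γ(U⧸K₀)} s(x)` with `a₀ = 0`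
and the empty sum (the fixed subtree is a single special vertex).  Letters of ★ FILE 1 VERBATIM + `hV₀ : #Fix_γ(U ⧸ K₀) = 0`; used by (E2♭) for the `κ = −1` class at `n = 0`
(`a₀ = phiTHprimen q 0 N = 0`, FILE 1a §0 + ★ (G2-ODD) A). [cite: Kottwitz1988, §2] [cite: Serre1980Trees, I.6.1] [cite: Flicker1998UnitaryFL, Prop. 17 p. 97] -/
theorem natCard_fixedBy_special_eq_one_of_natCard_fixedBy_hyperspecial_eq_zero {K : Type w} [Field K] [Valued K ℤᵐ⁰] [ValuativeRel K] [(Valued.v : Valuation K ℤᵐ⁰).Compatible]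
    {σ : K →+* K} {ϖ : K} (hd : UnramifiedLocalConjDatum σ ϖ)
    (g₁ : GL (Fin 3) K) (hg₁ : (g₁ : Matrix (Fin 3) (Fin 3) K) = Matrix.diagonal ![(1 : K), 1, ϖ])
    (γ : ↥(unitaryGroupOfForm σ ((StdForm.antidiagonal 3).over K)))
    [Fintype (fixedBy (↥(unitaryGroupOfForm σ ((StdForm.antidiagonal 3).over K)) ⧸
      (glInt 3 K).subgroupOf (unitaryGroupOfForm σ ((StdForm.antidiagonal 3).over K))) γ)]
    (hK₁fin : (fixedBy (↥(unitaryGroupOfForm σ ((StdForm.antidiagonal 3).over K)) ⧸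
      ((glInt 3 K).map (MulAut.conj g₁).toMonoidHom).subgroupOf (unitaryGroupOfForm σ ((StdForm.antidiagonal 3).over K))) γ).Finite)
    (horb : (Set.range fun n : ℕ => ((γ ^ n : ↥(unitaryGroupOfForm σ ((StdForm.antidiagonal 3).over K))) :
      ↥(unitaryGroupOfForm σ ((StdForm.antidiagonal 3).over K)) ⧸ (glInt 3 K).subgroupOf (unitaryGroupOfForm σ ((StdForm.antidiagonal 3).over K)))).Finite)
    (r : ↥(unitaryGroupOfForm σ ((StdForm.antidiagonal 3).over K)) ⧸ (glInt 3 K).subgroupOf (unitaryGroupOfForm σ ((StdForm.antidiagonal 3).over K)) →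
      ↥(unitaryGroupOfForm σ ((StdForm.antidiagonal 3).over K)))
    (hr : Function.RightInverse r QuotientGroup.mk)
    [∀ x : fixedBy (↥(unitaryGroupOfForm σ ((StdForm.antidiagonal 3).over K)) ⧸
        (glInt 3 K).subgroupOf (unitaryGroupOfForm σ ((StdForm.antidiagonal 3).over K))) γ,
      Finite (fixedBy (↥((glInt 3 K).subgroupOf (unitaryGroupOfForm σ ((StdForm.antidiagonal 3).over K))) ⧸
        (((glInt 3 K).subgroupOf (unitaryGroupOfForm σ ((StdForm.antidiagonal 3).over K)) ⊓
          ((glInt 3 K).map (MulAut.conj g₁).toMonoidHom).subgroupOf (unitaryGroupOfForm σ ((StdForm.antidiagonal 3).over K))).subgroupOf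
          ((glInt 3 K).subgroupOf (unitaryGroupOfForm σ ((StdForm.antidiagonal 3).over K)))))
        (⟨(r x.1)⁻¹ * γ * r x.1, inv_mul_mul_mem_of_smul_eq r hr γ x.2⟩ :
          ↥((glInt 3 K).subgroupOf (unitaryGroupOfForm σ ((StdForm.antidiagonal 3).over K)))))]
    (hV₀ : Nat.card (fixedBy (↥(unitaryGroupOfForm σ ((StdForm.antidiagonal 3).over K)) ⧸
      (glInt 3 K).subgroupOf (unitaryGroupOfForm σ ((StdForm.antidiagonal 3).over K))) γ) = 0) :
    Nat.card (fixedBy (↥(unitaryGroupOfForm σ ((StdForm.antidiagonal 3).over K)) ⧸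
        ((glInt 3 K).map (MulAut.conj g₁).toMonoidHom).subgroupOf (unitaryGroupOfForm σ ((StdForm.antidiagonal 3).over K))) γ) = 1 := by
  classical
  have h1 := natCard_fixedBy_special_add_eq_one_add_sum hd g₁ hg₁ γ hK₁fin horb r hr
  haveI : IsEmpty (fixedBy (↥(unitaryGroupOfForm σ ((StdForm.antidiagonal 3).over K)) ⧸
      (glInt 3 K).subgroupOf (unitaryGroupOfForm σ ((StdForm.antidiagonal 3).over K))) γ) := by
    rw [Nat.card_eq_fintype_card, Fintype.card_eq_zero_iff] at hV₀
    exact hV₀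
  rw [hV₀, add_zero, Finset.univ_eq_empty, Finset.sum_empty, add_zero] at h1
  exact h1

end Summit.HodgeConjecture.HodgeConjecture.R90.S6

end
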